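import Summits.Parity.GeneralizedHardyLittlewood.Theorems.RootExistenceConservationShapes

/-!
# Root existence conservation (2/4): the twin face, the Green–Tao pattern layer, the Siegel axis

Part of the CYCLE-2 ROOT CERTIFICATE «RootExistenceConservation» of the decomp-parity cell (lens-6 g9 NODE
HOME/STATUS.md l.468, REVISED v2 l.481; critic CLEARED l.472 = CRITIC-LEDGER row 87 against the spec (i)–(vi); writer
LANDING LIST L5 l.476).  The lens hand `HOME/decomp-parity-lens-6/g9/hand/RootExistenceConservation.lean`
(sha16 471e26ada0e68a15, 1250 lines, 99 theorems, 0 def, rc 0 · 0 sorry · standard axioms) is landed VERBATIM in four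
files for the 400-line Theorems lint by the cell's prover-class seat census-1 g10:
`RootExistenceConservationShapes` (§0–§2) → `RootExistenceConservationPatterns` (§3–§5a) →
`RootExistenceConservationTwins` (§5.1–§5.4) → `RootExistenceConservation` (§5.5–§5.9, barrier tie + door instances).
Vocabulary: `Theorems/RootExistenceConservationDefs.lean`.

§3 the twin face of route-Parity-ClusterGapCarving BY NAME; §4 the Green–Tao pattern layer BY NAME
(`SiegelSpectrumSplit.FixedUpper/FixedLower`, `ScaleTauberianCarving.FixedAt/ScaleRigidityAt`); §5a the Siegel axis is
orthogonal to existence content.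
-/

open scoped BigOperators
open Finset

namespace Summit.Parity.GeneralizedHardyLittlewood.ExistenceConservation

/-! ## §3 The twin face of route-Parity-ClusterGapCarving, BY NAME -/

open scoped ArithmeticFunction.vonMangoldt
open Literature.NumberTheory.Sieve

/-- The twin-type mass `X h N = Σ_{n≤N} Λ(n)Λ(n+h)` is non-negative. -/
theorem X_nonneg (h N : ℕ) : 0 ≤ X h N :=
  Finset.sum_nonneg fun _ _ =>
    mul_nonneg ArithmeticFunction.vonMangoldt_nonneg ArithmeticFunction.vonMangoldt_nonneg

/-- `𝔖({0,h}) ≥ 1` for even `h ≠ 0` (landed `EngineToPairs.Negative.one_le_singularSeries_pair_of_even`). -/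
theorem one_le_Spair {h : ℕ} (he : Even h) (hh : h ≠ 0) : 1 ≤ Spair h :=
  Theorems.EngineToPairs.Negative.one_le_singularSeries_pair_of_even he hh

/-- `Spair 2` is the twin singular series `𝔖({0,2})`. -/
theorem Spair_two : Spair 2 = singularSeries ({0, 2} : Finset ℤ) := by
  simp [Spair]

/-- `𝔖({0,2}) ≥ 1`. -/
theorem one_le_S2 : 1 ≤ singularSeries ({0, 2} : Finset ℤ) := by
  rw [← Spair_two]; exact one_le_Spair even_two two_ne_zero

/-- `PairSync` IS the shape `Sync` at every even shift against the twins. -/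
theorem pairSync_iff_sync : Theses.ClusterGapCarving.PairSync ↔
    ∀ h : ℕ, h ≠ 0 → Even h → Sync (X h) (X 2) (Spair h) (singularSeries ({0, 2} : Finset ℤ)) :=
  Iff.rfl

/-- C1 (VACUOUS): `PairSync` holds in the all-poor ghost world. -/
theorem pairSync_of_allPairsPoor (hW : AllPairsPoor) : Theses.ClusterGapCarving.PairSync :=
  pairSync_iff_sync.mpr fun h hh he => sync_of_poor (hW h hh he) (hW 2 two_ne_zero even_two)

/-- C2 (REFUTED in the asymmetric ghost world): if some even shift pair `h` is exact while the twins are poor,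
`PairSync` fails.  With C1: `PairSync` is twin-poverty-INDEPENDENT and carries RELATIVE content only. -/
theorem not_pairSync_of_asymmetric {h : ℕ} (hh : h ≠ 0) (he : Even h)
    (hE : Exact (X h) (Spair h)) (hT : TwinPoor) : ¬ Theses.ClusterGapCarving.PairSync := fun hS =>
  not_sync_of_exact_of_poor (lt_of_lt_of_le one_pos (one_le_Spair he hh)) (by linarith [one_le_S2]) hE hT
    (pairSync_iff_sync.mp hS h hh he)

/-- C3 (REFUTES the all-poor world): `FarSomePair` is false if every even shift pair is poor (`𝔖(h) ≥ 1`
uniformly in even `h`). -/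
theorem not_allPairsPoor_of_farSomePair (hF : Theses.ClusterGapCarving.FarSomePair) : ¬ AllPairsPoor := by
  intro hW
  obtain ⟨h, hh, he, N₁, A⟩ := hF (1 / 3) (by norm_num)
  obtain ⟨N₂, B⟩ := hW h hh he (1 / 3) (by norm_num)
  set N := max (max N₁ N₂) 1 with hNdef
  have a := A N (le_trans (le_max_left _ _) (le_max_left _ _))
  have b := B N (le_trans (le_max_right _ _) (le_max_left _ _))
  have hN1 : (1 : ℝ) ≤ N := by exact_mod_cast (le_max_right _ _ : 1 ≤ N)
  have hS := one_le_Spair he hh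
  have key : |(N : ℝ) * Spair h| ≤ 1 / 3 * N + 1 / 3 * N := by
    calc |(N : ℝ) * Spair h| = |X h N - (X h N - (N : ℝ) * Spair h)| := by ring_nf
      _ ≤ |X h N| + |X h N - (N : ℝ) * Spair h| := abs_sub _ _
      _ ≤ 1 / 3 * N + 1 / 3 * N := by unfold X Spair at *; linarith
  rw [abs_of_nonneg (by positivity : (0 : ℝ) ≤ N * Spair h)] at key
  nlinarith

/-- C4 (VACUOUS): the declared residual `TwinResidualRel` holds in the twin poverty world — its antecedent (the
eventual Λ-Chebyshev twin lower bound) is refuted there.  Same for the record's `TwinLowerDensityToGHL` shape. -/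
theorem twinResidualRel_of_twinPoor (hT : TwinPoor) : Theses.ClusterGapCarving.TwinResidualRel :=
  fun hch => absurd hT (not_poor_of_chebyshevEv hch)

/-- C5 (the route's EXISTENCE LOCUS): `FarSomePair ∧ PairSync` refutes the twin poverty world (via the landed glue
`twinLowerFromPairSync_proof`): by C1/C4 and `complement_refutes₂`, all existence content of the leaf sits in
this conjunction, divided between an ∃-existence statement for ANOTHER pair (C3) and a transfer (C1/C2). -/
theorem not_twinPoor_of_far_sync (hF : Theses.ClusterGapCarving.FarSomePair)
    (hS : Theses.ClusterGapCarving.PairSync) : ¬ TwinPoor :=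
  not_poor_of_chebyshevEv (Theses.ClusterGapCarving.twinLowerFromPairSync_proof hF hS)

/-- C5′: conversely neither half alone refutes twin poverty at shape level (`sync_independent`,
`someExact_independent`), and `PairSync` alone does not even refute the all-poor world (C1). -/
theorem pairSync_consistent_with_allPoor : AllPairsPoor → Theses.ClusterGapCarving.PairSync ∧ TwinPoor :=
  fun hW => ⟨pairSync_of_allPairsPoor hW, hW 2 two_ne_zero even_two⟩

/-! ## §4 The Green–Tao pattern layer, BY NAME (`SiegelSpectrumSplit.FixedUpper/FixedLower`,
`ScaleTauberianCarving.FixedAt/ScaleRigidityAt`) -/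

open ScaleTauberianCarving (err dil FixedAt ScaleRigidityAt convex_dil dil_subset_realBox)

variable {d t : ℕ}

/-- The record's `FixedUpper` (stmt-Parity-26852) IS `UpperAt` at every non-degenerate system. -/
theorem fixedUpper_iff : Theses.SiegelSpectrumSplit.FixedUpper ↔
    ∀ (d t : ℕ), 1 ≤ d → 1 ≤ t → ∀ Ψ : Fin t → AffLinForm d, IsNondegenerateSystem Ψ → UpperAt Ψ :=
  Iff.rfl

/-- The record's `FixedLower` (stmt-Parity-26863) IS `LowerAt` at every non-degenerate system. -/
theorem fixedLower_iff : Theses.SiegelSpectrumSplit.FixedLower ↔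
    ∀ (d t : ℕ), 1 ≤ d → 1 ≤ t → ∀ Ψ : Fin t → AffLinForm d, IsNondegenerateSystem Ψ → LowerAt Ψ :=
  Iff.rfl

/-- G1 (VACUOUS): the upper half at a poor pattern (main term `β_∞·𝔖 ≥ 0`, GreenTao2010 Lemma 1.3). -/
theorem upperAt_of_poorAt {Ψ : Fin t → AffLinForm d} (hΨ : IsNondegenerateSystem Ψ) (h : PoorAt Ψ) :
    UpperAt Ψ := by
  intro ε hε
  obtain ⟨N₀, h₀⟩ := h ε hε
  refine ⟨N₀, fun N hN K hK hKN => ?_⟩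
  have a := (abs_le.mp (h₀ N hN K hK hKN)).2
  have hM : 0 ≤ archFactor Ψ K * singularProduct Ψ :=
    mul_nonneg (archFactor_nonneg Ψ K) (GHLParityBoundary.singularProduct_nonneg_of_isNondegenerateSystem hΨ)
  linarith

/-- The upper half at an exact pattern (trivial). -/
theorem upperAt_of_fixedAt {Ψ : Fin t → AffLinForm d} (h : FixedAt Ψ) : UpperAt Ψ := by
  intro ε hε
  obtain ⟨N₀, h₀⟩ := h ε hε
  exact ⟨N₀, fun N hN K hK hKN => (abs_le.mp (h₀ N hN K hK hKN)).2⟩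

/-- G2: the record's `FixedUpper` HOLDS in every per-pattern ghost world (each non-degenerate system poor or
exact) — the upper half carries no existence content for any pattern. -/
theorem fixedUpper_of_ghostWorld
    (hW : ∀ (d t : ℕ), 1 ≤ d → 1 ≤ t → ∀ Ψ : Fin t → AffLinForm d, IsNondegenerateSystem Ψ →
      PoorAt Ψ ∨ FixedAt Ψ) : Theses.SiegelSpectrumSplit.FixedUpper :=
  fixedUpper_iff.mpr fun d t hd ht Ψ hΨ => (hW d t hd ht Ψ hΨ).elim (upperAt_of_poorAt hΨ) upperAt_of_fixedAt

/-- G3 (REFUTING): the lower half at a substantial pattern refutes its poverty — `FixedLower` carries the whole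
existence content of every pattern. -/
theorem not_poorAt_of_lowerAt {Ψ : Fin t → AffLinForm d} (hs : SubstantialAt Ψ) (h : LowerAt Ψ) :
    ¬ PoorAt Ψ := by
  intro hp
  obtain ⟨μ, hμ, N₁, h₁⟩ := hs
  obtain ⟨N₂, h₂⟩ := h (μ / 3) (by positivity)
  obtain ⟨N₃, h₃⟩ := hp (μ / 3) (by positivity)
  set N := max (max N₁ N₂) (max N₃ 1) with hNdef
  obtain ⟨K, hK, hKN, hmain⟩ := h₁ N (le_trans (le_max_left _ _) (le_max_left _ _))
  have a := h₂ N (le_trans (le_max_right _ _) (le_max_left _ _)) K hK hKN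
  have b := (abs_le.mp (h₃ N (le_trans (le_max_left _ _) (le_max_right _ _)) K hK hKN)).2
  have hN1 : (1 : ℝ) ≤ N := by exact_mod_cast (le_trans (le_max_right _ _) (le_max_right _ _) : 1 ≤ N)
  have hNd : (1 : ℝ) ≤ (N : ℝ) ^ d := one_le_pow₀ hN1
  nlinarith

/-- G4 (VACUOUS modulo main-term homogeneity): two-scale rigidity of the signed error (`ScaleRigidityAt`, item
stmt-Parity-31400 at one system) holds at every poor pattern — in `W` the normalised signed error is `≈ −(main
term)/N^d` at both scales. -/
theorem scaleRigidityAt_of_poorAt {Ψ : Fin t → AffLinForm d} (hH : HomogAt Ψ) (hp : PoorAt Ψ) :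
    ScaleRigidityAt Ψ := by
  intro ε hε
  obtain ⟨N₁, h₁⟩ := hH (ε / 3) (by positivity)
  obtain ⟨N₂, h₂⟩ := hp (ε / 3) (by positivity)
  refine ⟨max (max N₁ N₂) 1, fun N hN n hNn hnN K hK hKN => ?_⟩
  have hN₁ : N₁ ≤ N := le_trans (le_trans (le_max_left _ _) (le_max_left _ _)) hN
  have hN₂ : N₂ ≤ N := le_trans (le_trans (le_max_right _ _) (le_max_left _ _)) hN
  have hN1 : 1 ≤ N := le_trans (le_max_right _ _) hN
  have hN0 : N ≠ 0 := by omega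
  have hNpos : (0 : ℝ) < (N : ℝ) ^ d := by positivity
  have hnpos : (0 : ℝ) < (n : ℝ) ^ d := by
    have : (0 : ℝ) < n := by exact_mod_cast lt_of_lt_of_le (by omega : 0 < N) hNn
    positivity
  have hm := h₁ N hN₁ n hNn hnN K hK hKN
  have a := h₂ N hN₂ K hK hKN
  have b := h₂ n (le_trans hN₂ hNn) (dil N n K) (convex_dil hK N n) (dil_subset_realBox hN0 hKN)
  have ha : |vonMangoldtSum Ψ K N / (N : ℝ) ^ d| ≤ ε / 3 := by
    rw [abs_div, abs_of_pos hNpos, div_le_iff₀ hNpos]; exact a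
  have hb : |vonMangoldtSum Ψ (dil N n K) n / (n : ℝ) ^ d| ≤ ε / 3 := by
    rw [abs_div, abs_of_pos hnpos, div_le_iff₀ hnpos]; exact b
  have e : err Ψ K N / (N : ℝ) ^ d - err Ψ (dil N n K) n / (n : ℝ) ^ d
      = (vonMangoldtSum Ψ K N / (N : ℝ) ^ d - vonMangoldtSum Ψ (dil N n K) n / (n : ℝ) ^ d)
        - (archFactor Ψ K * singularProduct Ψ / (N : ℝ) ^ d -
            archFactor Ψ (dil N n K) * singularProduct Ψ / (n : ℝ) ^ d) := by
    simp only [err]; ring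
  rw [e]
  calc |(vonMangoldtSum Ψ K N / (N : ℝ) ^ d - vonMangoldtSum Ψ (dil N n K) n / (n : ℝ) ^ d)
        - (archFactor Ψ K * singularProduct Ψ / (N : ℝ) ^ d -
            archFactor Ψ (dil N n K) * singularProduct Ψ / (n : ℝ) ^ d)|
      ≤ |vonMangoldtSum Ψ K N / (N : ℝ) ^ d - vonMangoldtSum Ψ (dil N n K) n / (n : ℝ) ^ d|
        + |archFactor Ψ K * singularProduct Ψ / (N : ℝ) ^ d -
            archFactor Ψ (dil N n K) * singularProduct Ψ / (n : ℝ) ^ d| := abs_sub _ _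
    _ ≤ (|vonMangoldtSum Ψ K N / (N : ℝ) ^ d| + |vonMangoldtSum Ψ (dil N n K) n / (n : ℝ) ^ d|) + ε / 3 := by
        gcongr
        exact abs_sub _ _
    _ ≤ ε := by linarith

/-- G5: summary at one substantial, homogeneous pattern `Ψ` — of the record's two halves and lens-6's two
scale pieces, exactly `LowerAt` and (shape-level, `not_poor_of_logExact`) `LogWindowHLAt` refute poverty;
`UpperAt` and `ScaleRigidityAt` hold in the poverty world. -/
theorem pattern_trichotomy {Ψ : Fin t → AffLinForm d} (hΨ : IsNondegenerateSystem Ψ) (hs : SubstantialAt Ψ)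
    (hH : HomogAt Ψ) :
    (PoorAt Ψ → UpperAt Ψ ∧ ScaleRigidityAt Ψ) ∧ (LowerAt Ψ → ¬ PoorAt Ψ) :=
  ⟨fun hp => ⟨upperAt_of_poorAt hΨ hp, scaleRigidityAt_of_poorAt hH hp⟩, fun hl => not_poorAt_of_lowerAt hs hl⟩

/-! ## §5 The Siegel axis is orthogonal to existence content
In the twin-poverty world the record's Siegel crux `Q = SiegelSpectrumSplit.BoundedSiegelZeroQuality` HOLDS
(Heath-Brown 1983 in the quality form of Tao–Teräväinen Thm 1.5(i) / Matomäki–Merikoski Cor. 1.1(i); tree: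
`Literature.Barriers.Parity.robustHLFailure_eliminates`, modulo the named fact `MatomakiMerikoski2023_fixedShift`).
Hence `Q` is VACUOUS (class V) in `TwinPoor`, and conditioning any piece on `Q` never changes its class:
the Landau–Siegel axis (lens of the record route) and the existence axis are orthogonal. -/

/-- Twin poverty is a ROBUST failure of the pair asymptotic: eventually `C₂·x ≤ |Σ_{n≤x} Λ(n)Λ(n+2) − 𝔖₂x|`. -/
theorem twinPoor_robustFailure (hW : TwinPoor) :
    ∀ᶠ x : ℝ in Filter.atTop, twinPrimeConst * x ≤
      |(∑ n ∈ Finset.Icc 1 ⌊x⌋₊, Λ n * Λ (n + 2)) - x * goldbachSingularSeries 2| := by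
  have hC := twinPrimeConst_pos_holds
  obtain ⟨N₀, hN₀⟩ := hW _ hC
  filter_upwards [Filter.eventually_ge_atTop (N₀ : ℝ)] with x hx
  have hx0 : 0 ≤ x := le_trans (Nat.cast_nonneg N₀) hx
  have hfl : N₀ ≤ ⌊x⌋₊ := Nat.le_floor hx
  have hfl' : (⌊x⌋₊ : ℝ) ≤ x := Nat.floor_le hx0
  have h1 : X 2 ⌊x⌋₊ ≤ twinPrimeConst * ⌊x⌋₊ := (abs_le.mp (hN₀ _ hfl)).2
  have h2 : (∑ n ∈ Finset.Icc 1 ⌊x⌋₊, Λ n * Λ (n + 2)) = X 2 ⌊x⌋₊ := rfl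
  rw [h2, Literature.Barriers.Parity.goldbachSingularSeries_two, abs_sub_comm]
  have h3 : X 2 ⌊x⌋₊ ≤ twinPrimeConst * x := h1.trans (mul_le_mul_of_nonneg_left hfl' hC.le)
  have h4 : twinPrimeConst * x ≤ x * (2 * twinPrimeConst) - X 2 ⌊x⌋₊ := by linarith
  exact h4.trans (le_abs_self _)

/-- S1: `TwinPoor → Q` — in the poverty world Siegel zeros have bounded quality (mod the Matomäki–Merikoski fact). -/
theorem boundedSiegel_of_twinPoor (hMM : Literature.Barriers.Parity.MatomakiMerikoski2023_fixedShift)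
    (hW : TwinPoor) : Theses.SiegelSpectrumSplit.BoundedSiegelZeroQuality :=
  Literature.Barriers.Parity.robustHLFailure_eliminates hMM (h := 2) (by norm_num) twinPrimeConst_pos_holds
    (twinPoor_robustFailure hW)

/-- S2: conditioning on `Q` is class-neutral — a `Q`-conditioned piece `Q → Y` is vacuous in the twin-poverty
world iff `Y` is (mod MM). In particular the record split `Q ∧ UQ ∧ LQ` carries its existence content exactly
where the bare halves do (`LQ ⊇ twin lower bound`: refuting; `UQ`: twin-face vacuous). -/
theorem qConditioned_vacuous_iff (hMM : Literature.Barriers.Parity.MatomakiMerikoski2023_fixedShift) (Y : Prop) :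
    (TwinPoor → (Theses.SiegelSpectrumSplit.BoundedSiegelZeroQuality → Y)) ↔ (TwinPoor → Y) :=
  ⟨fun h hW => h hW (boundedSiegel_of_twinPoor hMM hW), fun h hW _ => h hW⟩

/-- S3: and a `Q`-conditioned piece refutes poverty iff its consequent does (mod MM). -/
theorem qConditioned_refuting_iff (hMM : Literature.Barriers.Parity.MatomakiMerikoski2023_fixedShift) (Y : Prop) :
    ((Theses.SiegelSpectrumSplit.BoundedSiegelZeroQuality → Y) → ¬ TwinPoor) ↔ (Y → ¬ TwinPoor) := by
  constructor
  · exact fun h hY => h (fun _ => hY)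
  · intro h hQY hW
    exact h (hQY (boundedSiegel_of_twinPoor hMM hW)) hW

end Summit.Parity.GeneralizedHardyLittlewood.ExistenceConservation
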